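import Mathlib.Algebra.BigOperators.Field
import Mathlib.Analysis.Polynomial.Basic
import Mathlib.Analysis.SpecialFunctions.Log.Deriv

/-!
# Beta / EriceFlowEnclosurePolyLogLetters — POLYLOGARITHMIC ASYMPTOTIC LETTERS, THE LINEAR CALCULUS (pure real analysis, SERVICE):
# the bookkeeping of expansions `f(y) = Σ_{k ≤ N} P_k(log y)∕y^k + O((1 + log y)^d∕y^{N+1})` (y → ∞) with POLYNOMIAL letters
# P_k ∈ ℝ[X] — crude bounds, sums, scalar and polynomial multiples — as needed by P2 #36g `…InverseLawAllOrders.inverse_law_allOrders`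
# (THE INVERSE LAW TO EVERY ORDER: the running coupling has a polylogarithmic asymptotic expansion to every order 1∕y^N as soon as the
# Λ-coordinate has one to order t^N) (β-flow team, prover 2 = lower ∕ positivity side, unit `b2b-balaban-beta-bflow-p2`, gen 21; module
# P2 #36g-A; companions P2 #36g-B `…PolyLogClosure` (truncation, shift, peeling; products, powers, log(1 + w), (1 + w)⁻¹), P2 #36g
# `…InverseLawAllOrders` (the induction), P2 #36c ∕ #36e `…InverseLawThird ∕ …InverseLawFourth` (the orders N = 1, 2 with EXPLICIT letters))

HONEST FRAMING (page 1 of everything the β sub-cell writes): discharging `BetaPertH` makes Bałaban's UV stability UNCONDITIONAL — a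
real constructive-QFT result; it is NOT the continuum limit and NOT the Clay problem.  HONEST DEPENDENCY (cell reorg 2026-08-19,
verbatim): «continuum YM on T⁴ ⇐ BetaPertH ∧ nine spine estimates (0/9 proved); BetaPertH ⇐ (D1) ∧ (D4) ∧ CAP+tail; G-an2-4 gates
asym, D1 and NE2/3/4.»  THIS MODULE DISCHARGES NOTHING: [folklore] real analysis in abstract letters (Mathlib's `Polynomial.eval`,
`Finset` sums, `Real.log`); no Erice sentence is consumed; nothing of (1.22).

THE SHAPE (written out in every statement — this file declares NO definition): for `f : ℝ → ℝ`, `N : ℕ`, letters `P : ℕ → Polynomial ℝ`,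
a constant `A : ℝ` and an exponent `d : ℕ`,
  «PL(N, f, P, A, d)» :≡ `∀ᶠ y in atTop, |f y − Σ_{k ∈ range (N+1)} (P k).eval (log y) ∕ y^k| ≤ A·(1 + log y)^d ∕ y^(N+1)`.

WHAT THIS FILE PROVES (0 sorry, 0 def, all [folklore]): `eval_abs_le` (|Q(L)| ≤ c·(1 + L)^{deg Q} for L ≥ 0), `partialSum_abs_le`,
`shiftedSum_abs_le` (crude bounds of the main parts), `abs_le_of_polyLog` ∕ `abs_le_div_of_polyLog` (a PL function is O((1 + log y)^D),
and O((1 + log y)^D∕y) when its constant letter vanishes), `polyLog_congr` (eventual equality), `polyLog_abs_const`, `polyLog_of_poly` (Q(log y) itself),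
`polyLog_of_error` (pure error terms), `polyLog_add`, `polyLog_const_mul`, `polyLog_sum` (finite sums, letters added), `polyLog_smul_poly`
(multiplication by Q(log y), letters Q·P_k).  (Truncation, shift, peeling and the nonlinear closure: P2 #36g-B `…PolyLogClosure`.)
NOT CLAIMED: degree bookkeeping of the letters (deg P_k ≤ k in the application) or of the error exponent; anything about the β-flow.
-/

namespace Summit.QuantumFields.BalabanUV.Beta.EriceFlowEnclosurePolyLogLetters

open Set Filter Topology

noncomputable section

/-! ## §1 Crude bounds -/

/-- `|Q(L)| ≤ (Σ_i |coeff_i Q|)·(1 + L)^{natDegree Q}` for `L ≥ 0`. [folklore] -/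
theorem eval_abs_le (Q : Polynomial ℝ) :
    ∃ c : ℝ, 0 ≤ c ∧ ∀ L : ℝ, 0 ≤ L → |Q.eval L| ≤ c * (1 + L) ^ Q.natDegree := by
  refine ⟨∑ i ∈ Finset.range (Q.natDegree + 1), |Q.coeff i|, Finset.sum_nonneg fun i _ => abs_nonneg _,
    fun L hL => ?_⟩
  rw [Polynomial.eval_eq_sum_range, Finset.sum_mul]
  refine (Finset.abs_sum_le_sum_abs _ _).trans (Finset.sum_le_sum fun i hi => ?_)
  rw [Finset.mem_range] at hi
  rw [abs_mul, abs_of_nonneg (pow_nonneg hL i)]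
  refine mul_le_mul_of_nonneg_left ?_ (abs_nonneg _)
  calc L ^ i ≤ (1 + L) ^ i := pow_le_pow_left₀ hL (by linarith) i
    _ ≤ (1 + L) ^ Q.natDegree := pow_le_pow_right₀ (by linarith) (by omega)

/-- Crude bound of a main part: `|Σ_{k<n} P_k(log y)∕y^k| ≤ c·(1 + log y)^D` for `y ≥ 1`. [folklore] -/
theorem partialSum_abs_le (P : ℕ → Polynomial ℝ) (n : ℕ) :
    ∃ c : ℝ, ∃ D : ℕ, 0 ≤ c ∧ ∀ y : ℝ, 1 ≤ y →
      |∑ k ∈ Finset.range n, (P k).eval (Real.log y) / y ^ k| ≤ c * (1 + Real.log y) ^ D := by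
  induction n with
  | zero => exact ⟨0, 0, le_rfl, fun y _ => by simp⟩
  | succ n ih =>
    obtain ⟨c, D, hc, h⟩ := ih
    obtain ⟨c', hc', h'⟩ := eval_abs_le (P n)
    refine ⟨c + c', max D (P n).natDegree, by positivity, fun y hy => ?_⟩
    have hL : 0 ≤ Real.log y := Real.log_nonneg hy
    have h1L : 1 ≤ 1 + Real.log y := by linarith
    rw [Finset.sum_range_succ]
    refine (abs_add_le _ _).trans ?_
    have hy0 : 0 < y := by linarith
    have hB : |(P n).eval (Real.log y) / y ^ n| ≤ c' * (1 + Real.log y) ^ (P n).natDegree := by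
      rw [abs_div, abs_of_pos (pow_pos hy0 n)]
      exact (div_le_self (abs_nonneg _) (one_le_pow₀ hy)).trans (h' _ hL)
    calc |∑ k ∈ Finset.range n, (P k).eval (Real.log y) / y ^ k| + |(P n).eval (Real.log y) / y ^ n|
        ≤ c * (1 + Real.log y) ^ D + c' * (1 + Real.log y) ^ (P n).natDegree := add_le_add (h y hy) hB
      _ ≤ c * (1 + Real.log y) ^ max D (P n).natDegree + c' * (1 + Real.log y) ^ max D (P n).natDegree :=
          add_le_add (mul_le_mul_of_nonneg_left (pow_le_pow_right₀ h1L (le_max_left _ _)) hc)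
            (mul_le_mul_of_nonneg_left (pow_le_pow_right₀ h1L (le_max_right _ _)) hc')
      _ = (c + c') * (1 + Real.log y) ^ max D (P n).natDegree := by ring

/-- Crude bound of a main part WITHOUT constant letter: `|Σ_{k<n} P_{k+1}(log y)∕y^{k+1}| ≤ c·(1 + log y)^D∕y` for `y ≥ 1`. [folklore] -/
theorem shiftedSum_abs_le (P : ℕ → Polynomial ℝ) (n : ℕ) :
    ∃ c : ℝ, ∃ D : ℕ, 0 ≤ c ∧ ∀ y : ℝ, 1 ≤ y →
      |∑ k ∈ Finset.range n, (P (k + 1)).eval (Real.log y) / y ^ (k + 1)| ≤ c * (1 + Real.log y) ^ D / y := by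
  obtain ⟨c, D, hc, h⟩ := partialSum_abs_le (fun k => P (k + 1)) n
  refine ⟨c, D, hc, fun y hy => ?_⟩
  have hy0 : 0 < y := by linarith
  have e : ∑ k ∈ Finset.range n, (P (k + 1)).eval (Real.log y) / y ^ (k + 1)
      = (∑ k ∈ Finset.range n, (P (k + 1)).eval (Real.log y) / y ^ k) / y := by
    rw [Finset.sum_div]
    refine Finset.sum_congr rfl fun k _ => ?_
    rw [pow_succ, div_div]
  rw [e, abs_div, abs_of_pos hy0]
  exact div_le_div_of_nonneg_right (h y hy) hy0.le

/-- A PL function is `O((1 + log y)^D)`. [folklore] -/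
theorem abs_le_of_polyLog {f : ℝ → ℝ} {N : ℕ} {P : ℕ → Polynomial ℝ} {A : ℝ} {d : ℕ}
    (hf : ∀ᶠ y : ℝ in atTop, |f y - ∑ k ∈ Finset.range (N + 1), (P k).eval (Real.log y) / y ^ k|
      ≤ A * (1 + Real.log y) ^ d / y ^ (N + 1)) :
    ∃ c : ℝ, ∃ D : ℕ, 0 ≤ c ∧ ∀ᶠ y : ℝ in atTop, |f y| ≤ c * (1 + Real.log y) ^ D := by
  obtain ⟨c, D, hc, h⟩ := partialSum_abs_le P (N + 1)
  refine ⟨|A| + c, max d D, by positivity, ?_⟩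
  filter_upwards [hf, eventually_ge_atTop (1 : ℝ)] with y hy hy1
  have hL : 0 ≤ Real.log y := Real.log_nonneg hy1
  have h1L : 1 ≤ 1 + Real.log y := by linarith
  have hS := h y hy1
  have h1 : A * (1 + Real.log y) ^ d / y ^ (N + 1) ≤ |A| * (1 + Real.log y) ^ max d D := by
    calc A * (1 + Real.log y) ^ d / y ^ (N + 1) ≤ |A| * (1 + Real.log y) ^ d / y ^ (N + 1) :=
          div_le_div_of_nonneg_right (mul_le_mul_of_nonneg_right (le_abs_self A) (by positivity)) (by positivity)
      _ ≤ |A| * (1 + Real.log y) ^ d := div_le_self (by positivity) (one_le_pow₀ hy1)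
      _ ≤ |A| * (1 + Real.log y) ^ max d D := mul_le_mul_of_nonneg_left (pow_le_pow_right₀ h1L (le_max_left _ _)) (abs_nonneg A)
  have h2 : c * (1 + Real.log y) ^ D ≤ c * (1 + Real.log y) ^ max d D :=
    mul_le_mul_of_nonneg_left (pow_le_pow_right₀ h1L (le_max_right _ _)) hc
  calc |f y| = |(f y - ∑ k ∈ Finset.range (N + 1), (P k).eval (Real.log y) / y ^ k)
        + ∑ k ∈ Finset.range (N + 1), (P k).eval (Real.log y) / y ^ k| := by rw [sub_add_cancel]
    _ ≤ |f y - ∑ k ∈ Finset.range (N + 1), (P k).eval (Real.log y) / y ^ k|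
        + |∑ k ∈ Finset.range (N + 1), (P k).eval (Real.log y) / y ^ k| := abs_add_le _ _
    _ ≤ |A| * (1 + Real.log y) ^ max d D + c * (1 + Real.log y) ^ max d D := add_le_add (hy.trans h1) (hS.trans h2)
    _ = (|A| + c) * (1 + Real.log y) ^ max d D := by ring

/-- A PL function WITHOUT constant letter is `O((1 + log y)^D∕y)`. [folklore] -/
theorem abs_le_div_of_polyLog {f : ℝ → ℝ} {N : ℕ} {P : ℕ → Polynomial ℝ} {A : ℝ} {d : ℕ}
    (hf : ∀ᶠ y : ℝ in atTop, |f y - ∑ k ∈ Finset.range (N + 1), (P k).eval (Real.log y) / y ^ k|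
      ≤ A * (1 + Real.log y) ^ d / y ^ (N + 1)) (hP0 : P 0 = 0) :
    ∃ c : ℝ, ∃ D : ℕ, 0 ≤ c ∧ ∀ᶠ y : ℝ in atTop, |f y| ≤ c * (1 + Real.log y) ^ D / y := by
  obtain ⟨c, D, hc, h⟩ := shiftedSum_abs_le P N
  refine ⟨|A| + c, max d D, by positivity, ?_⟩
  filter_upwards [hf, eventually_ge_atTop (1 : ℝ)] with y hy hy1
  have hy0 : 0 < y := by linarith
  have hL : 0 ≤ Real.log y := Real.log_nonneg hy1
  have h1L : 1 ≤ 1 + Real.log y := by linarith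
  have hS := h y hy1
  have eS : ∑ k ∈ Finset.range (N + 1), (P k).eval (Real.log y) / y ^ k
      = ∑ k ∈ Finset.range N, (P (k + 1)).eval (Real.log y) / y ^ (k + 1) := by
    rw [Finset.sum_range_succ', hP0]
    simp
  have h1 : A * (1 + Real.log y) ^ d / y ^ (N + 1) ≤ |A| * (1 + Real.log y) ^ max d D / y := by
    have hyN : y ≤ y ^ (N + 1) := by
      calc y = y ^ 1 := (pow_one y).symm
        _ ≤ y ^ (N + 1) := pow_le_pow_right₀ hy1 (by omega)
    calc A * (1 + Real.log y) ^ d / y ^ (N + 1) ≤ |A| * (1 + Real.log y) ^ max d D / y ^ (N + 1) :=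
          div_le_div_of_nonneg_right (mul_le_mul (le_abs_self A) (pow_le_pow_right₀ h1L (le_max_left _ _))
            (by positivity) (abs_nonneg A)) (by positivity)
      _ ≤ |A| * (1 + Real.log y) ^ max d D / y := div_le_div_of_nonneg_left (by positivity) hy0 hyN
  have h2 : c * (1 + Real.log y) ^ D / y ≤ c * (1 + Real.log y) ^ max d D / y :=
    div_le_div_of_nonneg_right (mul_le_mul_of_nonneg_left (pow_le_pow_right₀ h1L (le_max_right _ _)) hc) hy0.le
  have hS' : |∑ k ∈ Finset.range (N + 1), (P k).eval (Real.log y) / y ^ k| ≤ c * (1 + Real.log y) ^ D / y := by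
    rw [eS]; exact hS
  calc |f y| = |(f y - ∑ k ∈ Finset.range (N + 1), (P k).eval (Real.log y) / y ^ k)
        + ∑ k ∈ Finset.range (N + 1), (P k).eval (Real.log y) / y ^ k| := by rw [sub_add_cancel]
    _ ≤ |f y - ∑ k ∈ Finset.range (N + 1), (P k).eval (Real.log y) / y ^ k|
        + |∑ k ∈ Finset.range (N + 1), (P k).eval (Real.log y) / y ^ k| := abs_add_le _ _
    _ ≤ |A| * (1 + Real.log y) ^ max d D / y + c * (1 + Real.log y) ^ max d D / y :=
        add_le_add (hy.trans h1) (hS'.trans h2)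
    _ = (|A| + c) * (1 + Real.log y) ^ max d D / y := by ring

/-! ## §2 The linear calculus -/

/-- PL is stable under eventual equality of the function. [folklore] -/
theorem polyLog_congr {f g : ℝ → ℝ} {N : ℕ} {P : ℕ → Polynomial ℝ} {A : ℝ} {d : ℕ}
    (hf : ∀ᶠ y : ℝ in atTop, |f y - ∑ k ∈ Finset.range (N + 1), (P k).eval (Real.log y) / y ^ k|
      ≤ A * (1 + Real.log y) ^ d / y ^ (N + 1)) (hfg : ∀ᶠ y : ℝ in atTop, f y = g y) :
    ∀ᶠ y : ℝ in atTop, |g y - ∑ k ∈ Finset.range (N + 1), (P k).eval (Real.log y) / y ^ k|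
      ≤ A * (1 + Real.log y) ^ d / y ^ (N + 1) := by
  filter_upwards [hf, hfg] with y hy he
  rw [← he]; exact hy

/-- The error constant may be replaced by its absolute value (so a nonnegative constant is always available). [folklore] -/
theorem polyLog_abs_const {f : ℝ → ℝ} {N : ℕ} {P : ℕ → Polynomial ℝ} {A : ℝ} {d : ℕ}
    (hf : ∀ᶠ y : ℝ in atTop, |f y - ∑ k ∈ Finset.range (N + 1), (P k).eval (Real.log y) / y ^ k|
      ≤ A * (1 + Real.log y) ^ d / y ^ (N + 1)) :
    ∀ᶠ y : ℝ in atTop, |f y - ∑ k ∈ Finset.range (N + 1), (P k).eval (Real.log y) / y ^ k|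
      ≤ |A| * (1 + Real.log y) ^ d / y ^ (N + 1) := by
  filter_upwards [hf, eventually_ge_atTop (1 : ℝ)] with y hy hy1
  have hL : 0 ≤ Real.log y := Real.log_nonneg hy1
  exact hy.trans (div_le_div_of_nonneg_right (mul_le_mul_of_nonneg_right (le_abs_self A) (by positivity))
    (pow_nonneg (by linarith) _))

/-- A polynomial in `log y` is PL at every order, with itself as constant letter and no error. [folklore] -/
theorem polyLog_of_poly (Q : Polynomial ℝ) (N : ℕ) :
    ∀ᶠ y : ℝ in atTop, |Q.eval (Real.log y)
        - ∑ k ∈ Finset.range (N + 1), ((fun k : ℕ => if k = 0 then Q else 0) k).eval (Real.log y) / y ^ k|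
      ≤ 0 * (1 + Real.log y) ^ 0 / y ^ (N + 1) := by
  refine Eventually.of_forall fun y => ?_
  have e : ∑ k ∈ Finset.range (N + 1), ((fun k : ℕ => if k = 0 then Q else 0) k).eval (Real.log y) / y ^ k
      = Q.eval (Real.log y) := by
    rw [Finset.sum_range_succ']
    simp
  rw [e, sub_self, abs_zero, zero_mul, zero_div]

/-- A pure error term is PL with zero letters. [folklore] -/
theorem polyLog_of_error {f : ℝ → ℝ} {N : ℕ} {A : ℝ} {d : ℕ}
    (hf : ∀ᶠ y : ℝ in atTop, |f y| ≤ A * (1 + Real.log y) ^ d / y ^ (N + 1)) :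
    ∀ᶠ y : ℝ in atTop, |f y - ∑ k ∈ Finset.range (N + 1), ((fun _ : ℕ => (0 : Polynomial ℝ)) k).eval (Real.log y) / y ^ k|
      ≤ A * (1 + Real.log y) ^ d / y ^ (N + 1) := by
  filter_upwards [hf] with y hy
  simpa using hy

/-- **Sum**: letters add; the error constants and exponents combine. [folklore] -/
theorem polyLog_add {f g : ℝ → ℝ} {N : ℕ} {P Q : ℕ → Polynomial ℝ} {A B : ℝ} {d e : ℕ}
    (hf : ∀ᶠ y : ℝ in atTop, |f y - ∑ k ∈ Finset.range (N + 1), (P k).eval (Real.log y) / y ^ k|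
      ≤ A * (1 + Real.log y) ^ d / y ^ (N + 1))
    (hg : ∀ᶠ y : ℝ in atTop, |g y - ∑ k ∈ Finset.range (N + 1), (Q k).eval (Real.log y) / y ^ k|
      ≤ B * (1 + Real.log y) ^ e / y ^ (N + 1)) :
    ∃ A' : ℝ, ∃ d' : ℕ, ∀ᶠ y : ℝ in atTop,
      |(f y + g y) - ∑ k ∈ Finset.range (N + 1), ((fun k => P k + Q k) k).eval (Real.log y) / y ^ k|
        ≤ A' * (1 + Real.log y) ^ d' / y ^ (N + 1) := by
  refine ⟨|A| + |B|, max d e, ?_⟩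
  filter_upwards [hf, hg, eventually_ge_atTop (1 : ℝ)] with y hy hy' hy1
  have hL : 0 ≤ Real.log y := Real.log_nonneg hy1
  have h1L : 1 ≤ 1 + Real.log y := by linarith
  have hyp : 0 < y ^ (N + 1) := pow_pos (by linarith) _
  have e1 : ∑ k ∈ Finset.range (N + 1), ((fun k => P k + Q k) k).eval (Real.log y) / y ^ k
      = ∑ k ∈ Finset.range (N + 1), (P k).eval (Real.log y) / y ^ k
        + ∑ k ∈ Finset.range (N + 1), (Q k).eval (Real.log y) / y ^ k := by
    rw [← Finset.sum_add_distrib]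
    refine Finset.sum_congr rfl fun k _ => ?_
    simp only [Polynomial.eval_add, add_div]
  rw [e1]
  have h1 : A * (1 + Real.log y) ^ d / y ^ (N + 1) ≤ |A| * (1 + Real.log y) ^ max d e / y ^ (N + 1) :=
    div_le_div_of_nonneg_right (mul_le_mul (le_abs_self A) (pow_le_pow_right₀ h1L (le_max_left _ _))
      (by positivity) (abs_nonneg A)) hyp.le
  have h2 : B * (1 + Real.log y) ^ e / y ^ (N + 1) ≤ |B| * (1 + Real.log y) ^ max d e / y ^ (N + 1) :=
    div_le_div_of_nonneg_right (mul_le_mul (le_abs_self B) (pow_le_pow_right₀ h1L (le_max_right _ _))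
      (by positivity) (abs_nonneg B)) hyp.le
  calc |f y + g y - (∑ k ∈ Finset.range (N + 1), (P k).eval (Real.log y) / y ^ k
          + ∑ k ∈ Finset.range (N + 1), (Q k).eval (Real.log y) / y ^ k)|
      = |(f y - ∑ k ∈ Finset.range (N + 1), (P k).eval (Real.log y) / y ^ k)
          + (g y - ∑ k ∈ Finset.range (N + 1), (Q k).eval (Real.log y) / y ^ k)| := by congr 1; ring
    _ ≤ |f y - ∑ k ∈ Finset.range (N + 1), (P k).eval (Real.log y) / y ^ k|
          + |g y - ∑ k ∈ Finset.range (N + 1), (Q k).eval (Real.log y) / y ^ k| := abs_add_le _ _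
    _ ≤ |A| * (1 + Real.log y) ^ max d e / y ^ (N + 1) + |B| * (1 + Real.log y) ^ max d e / y ^ (N + 1) :=
        add_le_add (hy.trans h1) (hy'.trans h2)
    _ = (|A| + |B|) * (1 + Real.log y) ^ max d e / y ^ (N + 1) := by ring

/-- **Scalar multiple**: letters `C a·P_k`, constant `|a|·A`. [folklore] -/
theorem polyLog_const_mul {f : ℝ → ℝ} {N : ℕ} {P : ℕ → Polynomial ℝ} {A : ℝ} {d : ℕ} (a : ℝ)
    (hf : ∀ᶠ y : ℝ in atTop, |f y - ∑ k ∈ Finset.range (N + 1), (P k).eval (Real.log y) / y ^ k|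
      ≤ A * (1 + Real.log y) ^ d / y ^ (N + 1)) :
    ∀ᶠ y : ℝ in atTop,
      |a * f y - ∑ k ∈ Finset.range (N + 1), ((fun k => Polynomial.C a * P k) k).eval (Real.log y) / y ^ k|
        ≤ |a| * A * (1 + Real.log y) ^ d / y ^ (N + 1) := by
  filter_upwards [hf] with y hy
  have e1 : ∑ k ∈ Finset.range (N + 1), ((fun k => Polynomial.C a * P k) k).eval (Real.log y) / y ^ k
      = a * ∑ k ∈ Finset.range (N + 1), (P k).eval (Real.log y) / y ^ k := by
    rw [Finset.mul_sum]
    refine Finset.sum_congr rfl fun k _ => ?_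
    simp only [Polynomial.eval_mul, Polynomial.eval_C, mul_div_assoc]
  rw [e1, ← mul_sub, abs_mul, mul_assoc, mul_div_assoc]
  exact mul_le_mul_of_nonneg_left hy (abs_nonneg a)

/-- **Finite sums**: if every `f i` (i < n) is PL with letters `P i`, then `Σ_{i<n} f i` is PL with letters `k ↦ Σ_{i<n} P i k`. [folklore] -/
theorem polyLog_sum {N : ℕ} (f : ℕ → ℝ → ℝ) (P : ℕ → ℕ → Polynomial ℝ) :
    ∀ n : ℕ, (∀ i, i < n → ∃ A : ℝ, ∃ d : ℕ, ∀ᶠ y : ℝ in atTop,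
        |f i y - ∑ k ∈ Finset.range (N + 1), (P i k).eval (Real.log y) / y ^ k| ≤ A * (1 + Real.log y) ^ d / y ^ (N + 1)) →
      ∃ A : ℝ, ∃ d : ℕ, ∀ᶠ y : ℝ in atTop,
        |(∑ i ∈ Finset.range n, f i y)
            - ∑ k ∈ Finset.range (N + 1), ((fun k => ∑ i ∈ Finset.range n, P i k) k).eval (Real.log y) / y ^ k|
          ≤ A * (1 + Real.log y) ^ d / y ^ (N + 1) := by
  intro n
  induction n with
  | zero =>
    intro _
    refine ⟨0, 0, Eventually.of_forall fun y => ?_⟩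
    simp
  | succ n ih =>
    intro h
    obtain ⟨A, d, hA⟩ := ih fun i hi => h i (Nat.lt_succ_of_lt hi)
    obtain ⟨B, e, hB⟩ := h n (Nat.lt_succ_self n)
    obtain ⟨A', d', h'⟩ := polyLog_add hA hB
    refine ⟨A', d', ?_⟩
    filter_upwards [h'] with y hy
    have e1 : ∑ i ∈ Finset.range (n + 1), f i y = (∑ i ∈ Finset.range n, f i y) + f n y := Finset.sum_range_succ _ _
    have e2 : ∑ k ∈ Finset.range (N + 1), ((fun k => ∑ i ∈ Finset.range (n + 1), P i k) k).eval (Real.log y) / y ^ k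
        = ∑ k ∈ Finset.range (N + 1),
            ((fun k => (fun k => ∑ i ∈ Finset.range n, P i k) k + P n k) k).eval (Real.log y) / y ^ k := by
      refine Finset.sum_congr rfl fun k _ => ?_
      simp only [Finset.sum_range_succ]
    rw [e1, e2]
    exact hy

/-- **Multiplication by a polynomial in log y**: letters `Q·P_k`. [folklore] -/
theorem polyLog_smul_poly {f : ℝ → ℝ} {N : ℕ} {P : ℕ → Polynomial ℝ} {A : ℝ} {d : ℕ} (Q : Polynomial ℝ)
    (hf : ∀ᶠ y : ℝ in atTop, |f y - ∑ k ∈ Finset.range (N + 1), (P k).eval (Real.log y) / y ^ k|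
      ≤ A * (1 + Real.log y) ^ d / y ^ (N + 1)) :
    ∃ A' : ℝ, ∃ d' : ℕ, ∀ᶠ y : ℝ in atTop,
      |Q.eval (Real.log y) * f y - ∑ k ∈ Finset.range (N + 1), ((fun k => Q * P k) k).eval (Real.log y) / y ^ k|
        ≤ A' * (1 + Real.log y) ^ d' / y ^ (N + 1) := by
  obtain ⟨c, hc, h⟩ := eval_abs_le Q
  refine ⟨c * |A|, Q.natDegree + d, ?_⟩
  filter_upwards [hf, eventually_ge_atTop (1 : ℝ)] with y hy hy1
  have hL : 0 ≤ Real.log y := Real.log_nonneg hy1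
  have hyp : 0 < y ^ (N + 1) := pow_pos (by linarith) _
  have e1 : ∑ k ∈ Finset.range (N + 1), ((fun k => Q * P k) k).eval (Real.log y) / y ^ k
      = Q.eval (Real.log y) * ∑ k ∈ Finset.range (N + 1), (P k).eval (Real.log y) / y ^ k := by
    rw [Finset.mul_sum]
    refine Finset.sum_congr rfl fun k _ => ?_
    simp only [Polynomial.eval_mul, mul_div_assoc]
  rw [e1, ← mul_sub, abs_mul]
  have hA' : A * (1 + Real.log y) ^ d / y ^ (N + 1) ≤ |A| * (1 + Real.log y) ^ d / y ^ (N + 1) :=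
    div_le_div_of_nonneg_right (mul_le_mul_of_nonneg_right (le_abs_self A) (by positivity)) hyp.le
  calc |Q.eval (Real.log y)| * |f y - ∑ k ∈ Finset.range (N + 1), (P k).eval (Real.log y) / y ^ k|
      ≤ (c * (1 + Real.log y) ^ Q.natDegree) * (|A| * (1 + Real.log y) ^ d / y ^ (N + 1)) :=
        mul_le_mul (h _ hL) (hy.trans hA') (abs_nonneg _) (by positivity)
    _ = c * |A| * (1 + Real.log y) ^ (Q.natDegree + d) / y ^ (N + 1) := by rw [pow_add]; ring

end

end Summit.QuantumFields.BalabanUV.Beta.EriceFlowEnclosurePolyLogLetters
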